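import Summits.AtomisticToContinuum.HydrodynamicLimit.Theorems.AntiMazurCoboundariesCorrectorPressureDecayTangentTightnessLaplaceUniqueness

/-!
# Setwise upgrade of vague convergence, I: events inside an open set are generated by the exponential statistics supported in it (line `FirstLemma`, crux stmt-AtomisticToContinuum-14135)

Helper file of the registered stub `stub_setwiseWindowLimit_of_domination` (skeleton v10 of line `FirstLemma`, idea
`kifer-compactification`), namespace `Summit.AtomisticToContinuum.HydrodynamicLimit.Theorems.KiferCompactification`.

For an OPEN subset `V` of a locally compact second countable Hausdorff space `X`, consider the σ-algebra `𝓜_V` on the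
locally finite configurations `PointConfig X` generated by the exponential statistics `ω ↦ exp(-∑_{p ∈ ω} f p)` of the
test functions `f ∈ C_c⁺(X)` whose topological support lies INSIDE `V`. The restriction map `ω ↦ ω ∩ V` is
`𝓜_V`-measurable (`measurable_restrict_iSup_comap`): every event of the configuration seen in `V` is generated by
these statistics. Steps: a compact `K ⊆ V` is the exact level set `g⁻¹{1}` of some `g ∈ C_c(X, [0,1])` with
`tsupport g ⊆ V` (`exists_continuous_preimage_one_tsupport_subset`, Urysohn for `Gδ` compact sets inside a compact
neighbourhood of `K` in `V`); `N(K)` is the monotone limit of the linear statistics of `g^{n+1}` (tree: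
`sumFn_pow_succ_facts`), so `{N(K) < t} ∈ 𝓜_V`; counts of `V ∩ K`, `K` compact, by a compact exhaustion of `V`; and a
map into configurations is measurable once the counts of compact sets are (tree: `measurable_of_measurable_count_isCompact`).
No new definitions (the σ-algebra is written as an explicit `⨆` of `MeasurableSpace.comap`s, the form consumed by the
tree's functional monotone class theorem `stub_cylinderDenseL1`).

References: O. Kallenberg, *Foundations of Modern Probability*, 2nd ed. (2002), Lemma 12.1, Thm. A2.3.
-/

noncomputable section

open MeasureTheory Set Filter Topology Function
open scoped ENNReal NNReal

namespace Summit.AtomisticToContinuum.HydrodynamicLimit.Theorems.KiferCompactification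

open Literature.Analysis.FunctionSpaces (PointConfig)

variable {X : Type*} [TopologicalSpace X] [T2Space X] [LocallyCompactSpace X] [SecondCountableTopology X]

/-! ## Urysohn functions supported inside an open set -/

/-- For a compact `K` inside an open `V` there is `g ∈ C_c(X, [0,1])` with `K = g⁻¹{1}` EXACTLY and `tsupport g ⊆ V`
(Urysohn's lemma for the `Gδ` set `K` against the complement of the interior of a compact neighbourhood of `K` in `V`). -/
theorem exists_continuous_preimage_one_tsupport_subset {K V : Set X} (hK : IsCompact K) (hV : IsOpen V)
    (hKV : K ⊆ V) : ∃ g : C(X, ℝ), K = g ⁻¹' {1} ∧ HasCompactSupport g ∧ (∀ x, g x ∈ Icc (0 : ℝ) 1) ∧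
      tsupport g ⊆ V := by
  obtain ⟨L, hL, hKL, hLV⟩ := exists_compact_between hK hV hKV
  obtain ⟨g, h1, h0, hgc, h01⟩ := exists_continuous_one_zero_of_isCompact_of_isGδ hK hK.isClosed.isGδ
    isOpen_interior.isClosed_compl (disjoint_compl_right_iff_subset.2 hKL)
  refine ⟨g, h1, hgc, h01, ?_⟩
  have hsupp : support g ⊆ interior L := fun x hx => by_contra fun hx' => hx (h0 hx')
  calc tsupport g ⊆ closure (interior L) := closure_mono hsupp
    _ ⊆ L := by rw [hL.isClosed.closure_subset_iff]; exact interior_subset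
    _ ⊆ V := hLV

omit [T2Space X] [LocallyCompactSpace X] [SecondCountableTopology X] in
/-- Powers `g^{n+1}` of a `[0,1]`-valued `g ∈ C_c` supported inside `V` are admissible test functions of `V`. -/
theorem pow_succ_admissible {V : Set X} {g : C(X, ℝ)} (hgc : HasCompactSupport g) (hg01 : ∀ x, g x ∈ Icc (0 : ℝ) 1)
    (hgV : tsupport g ⊆ V) (n : ℕ) :
    Continuous (fun x => g x ^ (n + 1)) ∧ HasCompactSupport (fun x => g x ^ (n + 1)) ∧
      (∀ x, 0 ≤ g x ^ (n + 1)) ∧ tsupport (fun x => g x ^ (n + 1)) ⊆ V :=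
  ⟨g.continuous.pow _, hgc.comp_left (g := fun y : ℝ => y ^ (n + 1)) (by simp), fun x => pow_nonneg (hg01 x).1 _,
    (tsupport_comp_subset (g := fun y : ℝ => y ^ (n + 1)) (by simp) _).trans hgV⟩

/-! ## The σ-algebra of the exponential statistics supported in `V` -/

/-- **Counts of compact subsets of `V` are events of the exponential statistics supported in `V`**: for compact
`K ⊆ V`, `{N(K) < t}` is the increasing union of the events `{exp(-S_{g^{n+1}}) > e^{-t}}`, `g` as in
`exists_continuous_preimage_one_tsupport_subset`. -/
theorem measurableSet_count_lt_iSup_comap {V K : Set X} (hV : IsOpen V) (hK : IsCompact K) (hKV : K ⊆ V) (t : ℕ) :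
    MeasurableSet[⨆ f : {f : X → ℝ // Continuous f ∧ HasCompactSupport f ∧ (∀ x, 0 ≤ f x) ∧ tsupport f ⊆ V},
      MeasurableSpace.comap (fun ω : PointConfig X => Real.exp (-(ω.sumFn f.1))) inferInstance]
      {ω : PointConfig X | ω.count K < (t : ℕ∞)} := by
  obtain ⟨g, hgK, hgc, hg01, hgV⟩ := exists_continuous_preimage_one_tsupport_subset hK hV hKV
  have hfacts := fun ω : PointConfig X => sumFn_pow_succ_facts ω hgK hgc hg01 t
  have hU : {ω : PointConfig X | ω.count K < (t : ℕ∞)} =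
      ⋃ n : ℕ, {ω : PointConfig X | (ω.sumFn fun x => g x ^ (n + 1)) < t} := by
    ext ω
    simp only [mem_setOf_eq, mem_iUnion]
    exact ⟨fun h => ((hfacts ω).2.2 h).exists, fun ⟨n, hn⟩ => (hfacts ω).2.1 n hn⟩
  rw [hU]
  refine MeasurableSet.iUnion fun n => ?_
  set f₀ : {f : X → ℝ // Continuous f ∧ HasCompactSupport f ∧ (∀ x, 0 ≤ f x) ∧ tsupport f ⊆ V} :=
    ⟨fun x => g x ^ (n + 1), pow_succ_admissible hgc hg01 hgV n⟩ with hf₀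
  have hset : {ω : PointConfig X | (ω.sumFn fun x => g x ^ (n + 1)) < t} =
      (fun ω : PointConfig X => Real.exp (-(ω.sumFn f₀.1))) ⁻¹' Ioi (Real.exp (-(t : ℝ))) := by
    ext ω
    simp only [mem_setOf_eq, mem_preimage, mem_Ioi, Real.exp_lt_exp, neg_lt_neg_iff, hf₀]
  rw [hset]
  exact le_iSup (fun f : {f : X → ℝ // Continuous f ∧ HasCompactSupport f ∧ (∀ x, 0 ≤ f x) ∧ tsupport f ⊆ V} =>
    MeasurableSpace.comap (fun ω : PointConfig X => Real.exp (-(ω.sumFn f.1))) inferInstance) f₀ _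
    (comap_measurable _ measurableSet_Ioi)

/-- Counts of compact subsets of `V` are measurable for the σ-algebra of the exponential statistics supported in `V`
(`{N(K) = n} = {N(K) < n+1} \ {N(K) < n}`). -/
theorem measurable_count_iSup_comap_of_subset {V K : Set X} (hV : IsOpen V) (hK : IsCompact K) (hKV : K ⊆ V) :
    Measurable[⨆ f : {f : X → ℝ // Continuous f ∧ HasCompactSupport f ∧ (∀ x, 0 ≤ f x) ∧ tsupport f ⊆ V},
      MeasurableSpace.comap (fun ω : PointConfig X => Real.exp (-(ω.sumFn f.1))) inferInstance]
      fun ω : PointConfig X => ω.count K := by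
  refine (@ENat.measurable_iff _ (⨆ f : {f : X → ℝ // Continuous f ∧ HasCompactSupport f ∧ (∀ x, 0 ≤ f x) ∧
    tsupport f ⊆ V}, MeasurableSpace.comap (fun ω : PointConfig X => Real.exp (-(ω.sumFn f.1))) inferInstance) _).2
    fun n => ?_
  have : (fun ω : PointConfig X => ω.count K) ⁻¹' {(n : ℕ∞)} =
      {ω | ω.count K < ((n + 1 : ℕ) : ℕ∞)} \ {ω | ω.count K < (n : ℕ∞)} := by
    ext ω
    simp only [mem_preimage, mem_singleton_iff, Set.mem_sdiff, mem_setOf_eq, not_lt, Nat.cast_add, Nat.cast_one]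
    constructor
    · intro hω
      rw [hω]
      exact ⟨by exact_mod_cast Nat.lt_succ_self n, le_rfl⟩
    · rintro ⟨h1, h2⟩
      exact le_antisymm ((ENat.lt_add_one_iff (ENat.coe_ne_top n)).1 h1) h2
  rw [this]
  exact (measurableSet_count_lt_iSup_comap hV hK hKV (n + 1)).diff (measurableSet_count_lt_iSup_comap hV hK hKV n)

omit [T2Space X] in
/-- An open subset of a locally compact second countable Hausdorff space has an increasing compact exhaustion. -/
theorem exists_compact_exhaustion_of_isOpen {V : Set X} (hV : IsOpen V) :
    ∃ L : ℕ → Set X, (∀ m, IsCompact (L m)) ∧ Monotone L ∧ (∀ m, L m ⊆ V) ∧ ⋃ m, L m = V := by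
  have hσ : IsSigmaCompact V := by
    haveI := hV.locallyCompactSpace
    exact isSigmaCompact_iff_sigmaCompactSpace.2 inferInstance
  obtain ⟨K, hKc, hKV⟩ := hσ
  refine ⟨Set.accumulate K, isCompact_accumulate hKc, Set.monotone_accumulate, fun m => ?_, ?_⟩
  · rw [← hKV]
    exact Set.accumulate_subset_iUnion m
  · rw [Set.iUnion_accumulate, hKV]

/-- **Counts inside `V` are measurable for the exponential statistics supported in `V`**: for every compact `K`,
`ω ↦ N_ω(V ∩ K)` is measurable (`N(V ∩ K) ≥ a` iff `N(L_m ∩ K) ≥ a` for some member `L_m` of a compact exhaustion of `V`). -/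
theorem measurable_count_inter_iSup_comap {V : Set X} (hV : IsOpen V) {K : Set X} (hK : IsCompact K) :
    Measurable[⨆ f : {f : X → ℝ // Continuous f ∧ HasCompactSupport f ∧ (∀ x, 0 ≤ f x) ∧ tsupport f ⊆ V},
      MeasurableSpace.comap (fun ω : PointConfig X => Real.exp (-(ω.sumFn f.1))) inferInstance]
      fun ω : PointConfig X => ω.count (V ∩ K) := by
  obtain ⟨L, hLc, hLmono, hLV, hLU⟩ := exists_compact_exhaustion_of_isOpen hV
  -- the covering `S m = L m ∪ Vᶜ` of `X`, whose traces on `V ∩ K` are the compact sets `L m ∩ K ⊆ V`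
  set S : ℕ → Set X := fun m => L m ∪ Vᶜ with hS
  have hSmono : Monotone S := fun m m' h => union_subset_union_left _ (hLmono h)
  have hSU : ⋃ m, S m = univ := by
    rw [hS]
    simp_rw [← Set.iUnion_union, hLU, Set.union_compl_self]
  have htrace : ∀ m, V ∩ K ∩ S m = L m ∩ K := by
    intro m
    ext x
    simp only [hS, mem_inter_iff, mem_union, mem_compl_iff]
    constructor
    · rintro ⟨⟨hxV, hxK⟩, hx | hx⟩
      · exact ⟨hx, hxK⟩
      · exact absurd hxV hx
    · rintro ⟨hxL, hxK⟩
      exact ⟨⟨hLV m hxL, hxK⟩, Or.inl hxL⟩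
  have hG : ∀ a m : ℕ, MeasurableSet[⨆ f : {f : X → ℝ // Continuous f ∧ HasCompactSupport f ∧ (∀ x, 0 ≤ f x) ∧
      tsupport f ⊆ V}, MeasurableSpace.comap (fun ω : PointConfig X => Real.exp (-(ω.sumFn f.1))) inferInstance]
      {ω : PointConfig X | (a : ℕ∞) ≤ ω.count (L m ∩ K)} := fun a m =>
    measurable_count_iSup_comap_of_subset hV ((hLc m).inter_right hK.isClosed)
      (inter_subset_left.trans (hLV m)) (show MeasurableSet (Ici (a : ℕ∞)) from MeasurableSet.of_discrete)
  have hG' : ∀ a : ℕ, MeasurableSet[⨆ f : {f : X → ℝ // Continuous f ∧ HasCompactSupport f ∧ (∀ x, 0 ≤ f x) ∧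
      tsupport f ⊆ V}, MeasurableSpace.comap (fun ω : PointConfig X => Real.exp (-(ω.sumFn f.1))) inferInstance]
      {ω : PointConfig X | (a : ℕ∞) ≤ ω.count (V ∩ K)} := by
    intro a
    have : {ω : PointConfig X | (a : ℕ∞) ≤ ω.count (V ∩ K)} = ⋃ m, {ω : PointConfig X | (a : ℕ∞) ≤ ω.count (L m ∩ K)} := by
      ext ω
      simp only [mem_setOf_eq, mem_iUnion]
      rw [ω.natCast_le_count_iff_exists (V ∩ K) hSmono hSU a]
      simp_rw [htrace]
    rw [this]
    exact MeasurableSet.iUnion fun m => hG a m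
  refine (@ENat.measurable_iff _ (⨆ f : {f : X → ℝ // Continuous f ∧ HasCompactSupport f ∧ (∀ x, 0 ≤ f x) ∧
    tsupport f ⊆ V}, MeasurableSpace.comap (fun ω : PointConfig X => Real.exp (-(ω.sumFn f.1))) inferInstance) _).2
    fun n => ?_
  have : (fun ω : PointConfig X => ω.count (V ∩ K)) ⁻¹' {(n : ℕ∞)} =
      {ω | (n : ℕ∞) ≤ ω.count (V ∩ K)} \ {ω | ((n + 1 : ℕ) : ℕ∞) ≤ ω.count (V ∩ K)} := by
    ext ω
    simp only [mem_preimage, mem_singleton_iff, Set.mem_sdiff, mem_setOf_eq, not_le, Nat.cast_add, Nat.cast_one]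
    constructor
    · intro hω
      rw [hω]
      exact ⟨le_rfl, by exact_mod_cast Nat.lt_succ_self n⟩
    · rintro ⟨h1, h2⟩
      exact le_antisymm ((ENat.lt_add_one_iff (ENat.coe_ne_top n)).1 h2) h1
  rw [this]
  exact (hG' n).diff (hG' (n + 1))

/-- **The configuration seen in an open set is measurable for the exponential statistics supported in it**
(Kallenberg 2002, Lemma 12.1 / Thm. A2.3, localised; main statement of this helper file of the registered stub
`stub_setwiseWindowLimit_of_domination`): for `V ⊆ Y` open in a locally compact second countable Hausdorff space, the
restriction `ω ↦ ω ∩ V` is measurable from the σ-algebra generated by `ω ↦ exp(-∑_{p ∈ ω} f p)`, `f ∈ C_c⁺(Y)` with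
`tsupport f ⊆ V`, to the count σ-algebra. Hence every event of the configuration in `V` is an event of these statistics. -/
theorem measurable_restrict_iSup_comap {Y : Type*} [TopologicalSpace Y] [T2Space Y] [LocallyCompactSpace Y]
    [SecondCountableTopology Y] [MeasurableSpace Y] [BorelSpace Y] {V : Set Y} (hV : IsOpen V) :
    Measurable[⨆ f : {f : Y → ℝ // Continuous f ∧ HasCompactSupport f ∧ (∀ x, 0 ≤ f x) ∧ tsupport f ⊆ V},
      MeasurableSpace.comap (fun ω : PointConfig Y => Real.exp (-(ω.sumFn f.1))) inferInstance]
      (PointConfig.restrict V : PointConfig Y → PointConfig Y) :=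
  @measurable_of_measurable_count_isCompact Y _ _ _ _ _ (PointConfig Y)
    (⨆ f : {f : Y → ℝ // Continuous f ∧ HasCompactSupport f ∧ (∀ x, 0 ≤ f x) ∧ tsupport f ⊆ V},
      MeasurableSpace.comap (fun ω : PointConfig Y => Real.exp (-(ω.sumFn f.1))) inferInstance)
    (PointConfig.restrict V) fun K hK => by
      simp_rw [PointConfig.count_restrict]
      exact measurable_count_inter_iSup_comap hV hK

end Summit.AtomisticToContinuum.HydrodynamicLimit.Theorems.KiferCompactification

end
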